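import Literature.MathematicalPhysics.QuantumFieldTheory.Balaban1983to89.T3UnitLawGaugeInvariance

/-!
# `Balaban1983to89.T3OrbitAverage` — the configuration space `SU(N)^{bonds}` of one lattice as a compact metrisable Borel space,
# and the ORBIT AVERAGE over the Haar probability measure of its gauge group: a gauge-invariant law is determined by its
# integrals of gauge-invariant CONTINUOUS functions

Cell `ym3-torus` (HUMAN RULING D-0037, YM ladder rung R3), seat `ym3-torus-p2` gen 2.  WHAT THIS IS NOT: not d = 4, not infinite
volume, not a mass gap, not Clay, not the expectations step (E3): measure-theoretic plumbing ([folklore] over the tree's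
definitions and Mathlib), recorded because the law-level reading of (E3) (`T3ContinuumUnitLaw`) consumes it.

CONTENT.  [Balaban1985Averaging] (8)–(12) p. 19: gauge transformations `u : T → G` act by `U^u(x,y) = u(x)U(x,y)u(y)⁻¹` and the
objects of interest are the gauge-invariant functions (12).  On `G = SU(N)`:
§1 `GaugeField P j SU(N) = SU(N)^{bonds}` with the product topology of the tree (`instTopologicalSpaceGaugeField`) is compact,
   Hausdorff, metrisable, second countable, and the product σ-algebra of `Setup` is its Borel σ-algebra (scoped instances);
   the action `(v, U) ↦ U^{v}` is jointly continuous; loop variables are continuous.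
§2 `haarTransf P j` = the Haar PROBABILITY measure of the gauge group `Site P j → SU(N)` (right invariant); the orbit average
   `orbAvg g U = ∫ g(U^{v}) dv` is gauge invariant (`orbAvg_gaugeAct`), continuous for continuous `g`, bounded with `g`; and
   **`integral_eq_integral_orbAvg`**: for a probability law `μ` on `SU(N)^{bonds}` invariant under every gauge transformation,
   `∫ g dμ = ∫ ḡ dμ` for every continuous `g` (Fubini) — so such a law is determined by gauge-invariant continuous functions.
-/

noncomputable section

open MeasureTheory Filter Topology BoundedContinuousFunction
open Literature.MathematicalPhysics.QuantumFieldTheory.Balaban1983to89.T3UnitLawGaugeInvariance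
open Literature.MathematicalPhysics.QuantumFieldTheory.Balaban1983to89.Missing
open Literature.MathematicalPhysics.QuantumFieldTheory.Balaban1983to89.T4Continuum
open Literature.MathematicalPhysics.QuantumFieldTheory.Balaban1983to89.B12RTGaugeInvariance254 (measurable_gaugeAct)

namespace Literature.MathematicalPhysics.QuantumFieldTheory.Balaban1983to89.T3OrbitAverage

/-! ## §1 Topology of the configuration space `SU(N)^{bonds}` -/

section Topology

variable {N : ℕ} [NeZero N] {P : Params} {j : ℕ}

/-- `SU(N)` is second countable (a subspace of the matrices). [folklore] -/
scoped instance instSecondCountableSU : SecondCountableTopology (Matrix.specialUnitaryGroup (Fin N) ℂ) := by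
  haveI := secondCountableTopology_matrix (n := Fin N)
  exact Topology.IsEmbedding.subtypeVal.secondCountableTopology

/-- `SU(N)^{bonds}` is compact. [folklore] -/
scoped instance instCompactSpaceGaugeField : CompactSpace (GaugeField P j (Matrix.specialUnitaryGroup (Fin N) ℂ)) :=
  inferInstanceAs (CompactSpace (PBond P j → Matrix.specialUnitaryGroup (Fin N) ℂ))

/-- `SU(N)^{bonds}` is Hausdorff. [folklore] -/
scoped instance instT2SpaceGaugeField : T2Space (GaugeField P j (Matrix.specialUnitaryGroup (Fin N) ℂ)) :=
  inferInstanceAs (T2Space (PBond P j → Matrix.specialUnitaryGroup (Fin N) ℂ))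

/-- `SU(N)^{bonds}` is metrisable. [folklore] -/
scoped instance instMetrizableGaugeField :
    TopologicalSpace.MetrizableSpace (GaugeField P j (Matrix.specialUnitaryGroup (Fin N) ℂ)) :=
  inferInstanceAs (TopologicalSpace.MetrizableSpace (PBond P j → Matrix.specialUnitaryGroup (Fin N) ℂ))

/-- `SU(N)^{bonds}` is second countable. [folklore] -/
scoped instance instSecondCountableGaugeField :
    SecondCountableTopology (GaugeField P j (Matrix.specialUnitaryGroup (Fin N) ℂ)) :=
  inferInstanceAs (SecondCountableTopology (PBond P j → Matrix.specialUnitaryGroup (Fin N) ℂ))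

/-- The product σ-algebra of `Setup` on `SU(N)^{bonds}` is the Borel σ-algebra of the product topology. [folklore] -/
scoped instance instBorelSpaceGaugeField : BorelSpace (GaugeField P j (Matrix.specialUnitaryGroup (Fin N) ℂ)) :=
  inferInstanceAs (BorelSpace (PBond P j → Matrix.specialUnitaryGroup (Fin N) ℂ))

/-- A gauge transformation acts continuously on `SU(N)^{bonds}`, jointly in `(v, U)`. [cite: Balaban1985Averaging, (8) p.19] -/
theorem continuous_gaugeAct_uncurry :
    Continuous fun p : (Site P j → Matrix.specialUnitaryGroup (Fin N) ℂ) ×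
        GaugeField P j (Matrix.specialUnitaryGroup (Fin N) ℂ) => GaugeField.gaugeAct p.1 p.2 := by
  refine continuous_pi fun b => ?_
  show Continuous fun p : (Site P j → Matrix.specialUnitaryGroup (Fin N) ℂ) ×
      GaugeField P j (Matrix.specialUnitaryGroup (Fin N) ℂ) => p.1 b.src * p.2 b * (p.1 b.tgt)⁻¹
  exact (((continuous_apply b.src).comp continuous_fst).mul
    ((show Continuous fun U : GaugeField P j (Matrix.specialUnitaryGroup (Fin N) ℂ) => U b from
      continuous_apply b).comp continuous_snd)).mul ((continuous_apply b.tgt).comp continuous_fst).inv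

/-- … with the arguments swapped (the order Fubini wants below). [cite: Balaban1985Averaging, (8) p.19] -/
theorem continuous_gaugeAct_uncurry' :
    Continuous fun p : GaugeField P j (Matrix.specialUnitaryGroup (Fin N) ℂ) ×
        (Site P j → Matrix.specialUnitaryGroup (Fin N) ℂ) => GaugeField.gaugeAct p.2 p.1 := by
  refine continuous_pi fun b => ?_
  show Continuous fun p : GaugeField P j (Matrix.specialUnitaryGroup (Fin N) ℂ) ×
      (Site P j → Matrix.specialUnitaryGroup (Fin N) ℂ) => p.2 b.src * p.1 b * (p.2 b.tgt)⁻¹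
  exact (((continuous_apply b.src).comp continuous_snd).mul
    ((show Continuous fun U : GaugeField P j (Matrix.specialUnitaryGroup (Fin N) ℂ) => U b from
      continuous_apply b).comp continuous_fst)).mul ((continuous_apply b.tgt).comp continuous_snd).inv

/-- … in particular continuously in `U` for fixed `v`. [cite: Balaban1985Averaging, (8) p.19] -/
theorem continuous_gaugeAct (v : Site P j → Matrix.specialUnitaryGroup (Fin N) ℂ) :
    Continuous (GaugeField.gaugeAct v :
      GaugeField P j (Matrix.specialUnitaryGroup (Fin N) ℂ) → GaugeField P j (Matrix.specialUnitaryGroup (Fin N) ℂ)) := by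
  refine continuous_pi fun b => ?_
  show Continuous fun U : GaugeField P j (Matrix.specialUnitaryGroup (Fin N) ℂ) => v b.src * U b * (v b.tgt)⁻¹
  exact (continuous_const.mul (show Continuous fun U : GaugeField P j (Matrix.specialUnitaryGroup (Fin N) ℂ) => U b from
    continuous_apply b)).mul continuous_const

/-- … and continuously in `v` for fixed `U`. [cite: Balaban1985Averaging, (8) p.19] -/
theorem continuous_gaugeAct_left (U : GaugeField P j (Matrix.specialUnitaryGroup (Fin N) ℂ)) :
    Continuous fun v : Site P j → Matrix.specialUnitaryGroup (Fin N) ℂ => GaugeField.gaugeAct v U := by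
  refine continuous_pi fun b => ?_
  show Continuous fun v : Site P j → Matrix.specialUnitaryGroup (Fin N) ℂ => v b.src * U b * (v b.tgt)⁻¹
  exact ((continuous_apply b.src).mul continuous_const).mul (continuous_apply b.tgt).inv

/-- Loop variables `Re tr U(γ)/N` are continuous on `SU(N)^{bonds}` (tree `BlockAveraging.continuous_holAt`).
[cite: Balaban1987RG1, (0.2) p.252] -/
theorem continuous_loopAt (γ : List (LStep P j)) :
    Continuous fun U : GaugeField P j (Matrix.specialUnitaryGroup (Fin N) ℂ) => loopAt U γ := by
  unfold T4Continuum.loopAt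
  have hre : Continuous (reTr : Matrix.specialUnitaryGroup (Fin N) ℂ → ℝ) :=
    UnitaryModel.continuous_nReTr.comp (Literature.MathematicalPhysics.QuantumLattice.continuous_fundamentalRep (Fin N))
  exact hre.comp (BlockAveraging.continuous_holAt γ)

omit [NeZero N] in
/-- Continuous real functions separate the points of `SU(N)^{bonds}` (it is metrisable: `dist x ·`).
[cite: Balaban1985Averaging, (12) p.19] -/
theorem continuousMap_separatesPoints (x y : GaugeField P j (Matrix.specialUnitaryGroup (Fin N) ℂ)) (hxy : x ≠ y) :
    ∃ f : C(GaugeField P j (Matrix.specialUnitaryGroup (Fin N) ℂ), ℝ),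
      (fun g : C(_, ℝ) => g) f x ≠ (fun g : C(_, ℝ) => g) f y := by
  letI := TopologicalSpace.metrizableSpaceMetric (GaugeField P j (Matrix.specialUnitaryGroup (Fin N) ℂ))
  refine ⟨⟨fun z => dist x z, continuous_const.dist continuous_id⟩, ?_⟩
  simp only [ContinuousMap.coe_mk, dist_self]
  exact fun h => hxy (dist_eq_zero.mp h.symm)

end Topology

/-! ## §2 The orbit average over the gauge group of one lattice -/

section Orbit

variable {N : ℕ} [NeZero N] {P : Params} {j : ℕ}

/-- The Haar PROBABILITY measure of the gauge group `SU(N)^{sites}` of the lattice `T^{(j)}`. [cite: Balaban1985Averaging, (10) p.19] -/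
def haarTransf (P : Params) (j : ℕ) : Measure (Site P j → Matrix.specialUnitaryGroup (Fin N) ℂ) :=
  Measure.pi fun _ => (HaarData.haar : Measure (Matrix.specialUnitaryGroup (Fin N) ℂ))

/-- The Haar measure of the gauge group is a probability measure. [cite: Balaban1985Averaging, (10) p.19] -/
instance isProbabilityMeasure_haarTransf :
    IsProbabilityMeasure (haarTransf (N := N) P j) := by
  haveI : IsProbabilityMeasure (HaarData.haar : Measure (Matrix.specialUnitaryGroup (Fin N) ℂ)) := HaarData.isProb
  unfold haarTransf
  infer_instance

/-- The Haar measure of the gauge group is right invariant. [cite: Balaban1985Averaging, (10) p.19] -/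
instance isMulRightInvariant_haarTransf : (haarTransf (N := N) P j).IsMulRightInvariant := by
  haveI : (HaarData.haar : Measure (Matrix.specialUnitaryGroup (Fin N) ℂ)).IsMulRightInvariant :=
    ⟨HaarData.map_mul_right⟩
  unfold haarTransf
  infer_instance

/-- **THE ORBIT AVERAGE** `ḡ(U) = ∫ g(U^{v}) dv` of a function on `SU(N)^{bonds}` over the Haar probability measure of the gauge
group. [cite: Balaban1985Averaging, (12) p.19] -/
def orbAvg (g : GaugeField P j (Matrix.specialUnitaryGroup (Fin N) ℂ) → ℝ)
    (U : GaugeField P j (Matrix.specialUnitaryGroup (Fin N) ℂ)) : ℝ :=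
  ∫ v, g (GaugeField.gaugeAct v U) ∂haarTransf P j

/-- The orbit average is GAUGE INVARIANT (`(U^{w})^{v} = U^{vw}` and right invariance of Haar). [cite: Balaban1985Averaging, (12) p.19] -/
theorem orbAvg_gaugeAct (g : GaugeField P j (Matrix.specialUnitaryGroup (Fin N) ℂ) → ℝ)
    (w : GaugeTransf P j (Matrix.specialUnitaryGroup (Fin N) ℂ)) (U : GaugeField P j (Matrix.specialUnitaryGroup (Fin N) ℂ)) :
    orbAvg g (GaugeField.gaugeAct w U) = orbAvg g U := by
  unfold orbAvg
  simp_rw [gaugeAct_gaugeAct]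
  exact integral_mul_right_eq_self (μ := haarTransf P j) (fun v => g (GaugeField.gaugeAct v U)) w

/-- A bound `|g| ≤ C` passes to the orbit average. [cite: Balaban1985Averaging, (12) p.19] -/
theorem abs_orbAvg_le {g : GaugeField P j (Matrix.specialUnitaryGroup (Fin N) ℂ) → ℝ} {C : ℝ} (hC : ∀ U, |g U| ≤ C)
    (U : GaugeField P j (Matrix.specialUnitaryGroup (Fin N) ℂ)) : |orbAvg g U| ≤ C := by
  unfold orbAvg
  have h := norm_integral_le_of_norm_le_const (μ := haarTransf (N := N) P j)
    (f := fun v => g (GaugeField.gaugeAct v U)) (C := C) (Eventually.of_forall fun v => by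
      rw [Real.norm_eq_abs]; exact hC _)
  simpa [Real.norm_eq_abs] using h

/-- The orbit average of a continuous function is CONTINUOUS (dominated convergence on the compact group).
[cite: Balaban1985Averaging, (12) p.19] -/
theorem continuous_orbAvg {g : GaugeField P j (Matrix.specialUnitaryGroup (Fin N) ℂ) → ℝ} (hg : Continuous g) :
    Continuous (orbAvg g) := by
  obtain ⟨C, hC⟩ := isCompact_univ.exists_bound_of_continuousOn (hg.continuousOn (s := Set.univ))
  exact MeasureTheory.continuous_of_dominated
    (F := fun (U : GaugeField P j (Matrix.specialUnitaryGroup (Fin N) ℂ))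
      (v : Site P j → Matrix.specialUnitaryGroup (Fin N) ℂ) => g (GaugeField.gaugeAct v U))
    (bound := fun _ => C) (μ := haarTransf P j)
    (fun U => (hg.comp (continuous_gaugeAct_left U)).aestronglyMeasurable)
    (fun U => Eventually.of_forall fun v => hC _ (Set.mem_univ _))
    (integrable_const C)
    (Eventually.of_forall fun v => hg.comp (continuous_gaugeAct v))

/-- … hence the orbit average of a continuous function is measurable. [cite: Balaban1985Averaging, (12) p.19] -/
theorem measurable_orbAvg {g : GaugeField P j (Matrix.specialUnitaryGroup (Fin N) ℂ) → ℝ} (hg : Continuous g) :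
    Measurable (orbAvg g) :=
  (continuous_orbAvg hg).measurable

/-- **FUBINI FOR GAUGE-INVARIANT LAWS**: if a probability law `μ` on `SU(N)^{bonds}` is invariant under every gauge transformation,
then `∫ g dμ = ∫ ḡ dμ` for every continuous `g` — a gauge-invariant law is determined by its values on gauge-invariant continuous
functions. [cite: Balaban1985Averaging, (12) p.19] -/
theorem integral_eq_integral_orbAvg (μ : Measure (GaugeField P j (Matrix.specialUnitaryGroup (Fin N) ℂ)))
    [IsProbabilityMeasure μ] (hμ : ∀ v, μ.map (GaugeField.gaugeAct v) = μ)
    {g : GaugeField P j (Matrix.specialUnitaryGroup (Fin N) ℂ) → ℝ} (hg : Continuous g) :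
    ∫ U, g U ∂μ = ∫ U, orbAvg g U ∂μ := by
  obtain ⟨C, hC⟩ := isCompact_univ.exists_bound_of_continuousOn (hg.continuousOn (s := Set.univ))
  -- for each `v`, `∫ g(U^v) dμ = ∫ g dμ`
  have h1 : ∀ v : Site P j → Matrix.specialUnitaryGroup (Fin N) ℂ,
      ∫ U, g (GaugeField.gaugeAct v U) ∂μ = ∫ U, g U ∂μ := fun v => by
    rw [← integral_map (measurable_gaugeAct v).aemeasurable hg.aestronglyMeasurable, hμ v]
  -- Fubini
  have hint : Integrable (Function.uncurry fun (U : GaugeField P j (Matrix.specialUnitaryGroup (Fin N) ℂ))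
      (v : Site P j → Matrix.specialUnitaryGroup (Fin N) ℂ) => g (GaugeField.gaugeAct v U)) (μ.prod (haarTransf P j)) := by
    refine T4VarianceMatching.integrable_of_abs_le _ ?_ (B := C) fun p => ?_
    · exact (hg.comp continuous_gaugeAct_uncurry').measurable
    · show |g (GaugeField.gaugeAct p.2 p.1)| ≤ C
      have hp := hC (GaugeField.gaugeAct p.2 p.1) (Set.mem_univ _)
      rwa [Real.norm_eq_abs] at hp
  unfold orbAvg
  rw [integral_integral_swap hint]
  simp_rw [h1]
  simp

end Orbit

end Literature.MathematicalPhysics.QuantumFieldTheory.Balaban1983to89.T3OrbitAverage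

end
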